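import Summits.CriticalPhenomena.PercolationContinuityZ3.Theorems.PercNearOneGluingNoHeavyLowerTailAttachedChampionCardSubTwoTools
import HarnessLib

/-!
# `NoHeavyLowerTail` (stmt-CriticalPhenomena-4575) — the attached-champion inequality at level `|A| − 2`

Lead of the crux, 2026-08-18.  `μ = prodBernoulli w` on `Fin n`, relays `A` with `k = |A| ≥ 3`, observer `o`, level
`j = k − 2`, `N = |π(o)|`, `R_a = {|π(a)| ≤ k−2}`.  The registered stub `stub_attachedChampion` (XZ) at this level:

* `attachedChampion_level_card_sub_two` — if `q ∈ A` is a level-`(k−2)` champion (`μ(R_a) ≤ μ(R_q)` for all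
  `a ∈ A`), then `μ(1 ≤ N ≤ k−2) ≤ μ(R_q ∩ {1 ≤ N})`.

So XZ is now a theorem at the levels `1` (`attachedChampion_level_one`), `|A| − 2` (here) and `≥ |A| − 1`
(where it is an identity), exactly the levels at which the cumulative isolation lemma is known; the attached form
is strictly sharper.  Combinatorics at level `k − 2`: `{1 ≤ N ≤ k−2} ∖ R_q ⊆ ⋃_{d ≠ q} ({o↔d} ∩ D_d ∩ Q_d)`
(`D_d = {d ↮ A∖d}`, `Q_d = {A∖d pairwise joined}`), `D_q ∩ ({o ↔ A∖q} ∩ Q_q) ⊆ R_q ∩ {1 ≤ N} ∖ {N ≤ k−2}`, and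
`R_q ∖ R_d = D_q ∩ Q_q` (so the level-`(k−2)` champion maximises `h(d) = μ(D_d ∩ Q_d)`); the probabilistic
input is `AttachedChampionCardSubTwo.chain_of_pairSep_pos` (tools file), the null separation event is removed by
scaling the weights (`stub_weightContinuity`).
-/

noncomputable section

namespace Summit.CriticalPhenomena.PercolationContinuityZ3.Theorems

open MeasureTheory Set Filter Literature.Probability.LatticeModels Literature.Probability.Percolation
open scoped Classical BigOperators Topology

namespace AttachedChampionCardSubTwo

variable {n : ℕ}

/-- **Cover at level `k − 2`.**  If `1 ≤ N ≤ k−2` but `|π(q)| ≥ k−1`, then `o`'s block is a single relay `d ≠ q`,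
isolated from `A ∖ d`, and `A ∖ d` is pairwise joined (it is `q`'s block). [folklore] -/
theorem cover_sdiff_subset (A : Finset (Fin n)) (o q : Fin n) (hq : q ∈ A) :
    {ω : BondConfig (Fin n) | 1 ≤ (A.filter fun x => ω ∈ openConn o x).card ∧
        (A.filter fun x => ω ∈ openConn o x).card ≤ A.card - 2} \
      {ω | (A.filter fun x => ω ∈ openConn q x).card ≤ A.card - 2} ⊆
    ⋃ d ∈ A.erase q, (openConn o d ∩ {ω : BondConfig (Fin n) | ∀ t ∈ A.erase d, ω ∉ openConn d t} ∩
      {ω | ∀ t ∈ (↑(A.erase d) : Set (Fin n)), ∀ t' ∈ (↑(A.erase d) : Set (Fin n)), ω ∈ openConn t t'}) := by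
  rintro ω ⟨⟨h1, hle⟩, hnR⟩
  simp only [Set.mem_setOf_eq, not_le] at hnR
  set So := A.filter fun x => ω ∈ openConn o x with hSo
  set Sq := A.filter fun x => ω ∈ openConn q x with hSq
  have hk : 1 ≤ A.card := Finset.card_pos.2 ⟨q, hq⟩
  -- `o ↮ q`
  have hoq : ¬ (openGraph ω).Reachable o q := by
    intro h
    have heq : So = Sq := by
      refine Finset.filter_congr fun x _ => ?_
      change (openGraph ω).Reachable o x ↔ (openGraph ω).Reachable q x
      exact ⟨fun hx => h.symm.trans hx, fun hx => h.trans hx⟩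
    rw [heq] at hle
    omega
  -- the two blocks are disjoint subsets of `A`
  have hdisj : Disjoint So Sq := by
    rw [hSo, hSq, Finset.disjoint_filter]
    intro x _ hox hqx
    exact hoq ((show (openGraph ω).Reachable o x from hox).trans (show (openGraph ω).Reachable q x from hqx).symm)
  have hcard : So.card + Sq.card ≤ A.card := by
    rw [← Finset.card_union_of_disjoint hdisj]
    exact Finset.card_le_card (Finset.union_subset (Finset.filter_subset _ _) (Finset.filter_subset _ _))
  have hSo1 : So.card = 1 := by omega
  have hSq1 : Sq.card = A.card - 1 := by omega
  obtain ⟨d, hd⟩ := Finset.card_eq_one.1 hSo1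
  have hdSo : d ∈ So := by rw [hd]; exact Finset.mem_singleton_self d
  obtain ⟨hdA, hod⟩ := Finset.mem_filter.1 hdSo
  have hdSq : d ∉ Sq := Finset.disjoint_left.1 hdisj hdSo
  have hqSq : q ∈ Sq := Finset.mem_filter.2 ⟨hq, (SimpleGraph.Reachable.refl q : (openGraph ω).Reachable q q)⟩
  have hdq : d ≠ q := fun h => hdSq (h ▸ hqSq)
  -- `q`'s block is exactly `A ∖ d`
  have hSq_sub : Sq ⊆ A.erase d := fun x hx =>
    Finset.mem_erase.2 ⟨fun h => hdSq (h ▸ hx), (Finset.mem_filter.1 hx).1⟩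
  have hSq_eq : Sq = A.erase d :=
    Finset.eq_of_subset_of_card_le hSq_sub (by rw [Finset.card_erase_of_mem hdA, hSq1])
  have hconn : ∀ t ∈ A.erase d, (openGraph ω).Reachable q t := fun t ht => by
    rw [← hSq_eq] at ht; exact (Finset.mem_filter.1 ht).2
  refine Set.mem_iUnion₂.2 ⟨d, Finset.mem_erase.2 ⟨hdq, hdA⟩, ⟨hod, ?_⟩, ?_⟩
  · intro t ht hdt
    have : d ∈ Sq := Finset.mem_filter.2 ⟨hdA,
      ((hconn t ht).trans (show (openGraph ω).Reachable d t from hdt).symm)⟩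
    exact hdSq this
  · intro t ht t' ht'
    exact ((hconn t ht).symm.trans (hconn t' ht') : (openGraph ω).Reachable t t')

/-- **The good piece at level `k − 2`** (`k = |A| ≥ 3`): on `D_q ∩ {o ↔ A∖q} ∩ Q_q` the observer's block is
`A ∖ q` (heavy) and `q` is isolated (light), so this event lies in `R_q ∩ {1 ≤ N}` and misses `{N ≤ k−2}`;
hence `μ({1≤N≤k−2} ∩ R_q) + μ(D_q ∩ ({o↔A∖q} ∩ Q_q)) ≤ μ(R_q ∩ {1 ≤ N})`. [folklore] -/
theorem good_piece_le (w : Sym2 (Fin n) → unitInterval) (A : Finset (Fin n)) (o q : Fin n) (hq : q ∈ A)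
    (hk : 3 ≤ A.card) :
    (prodBernoulli w).real ({ω : BondConfig (Fin n) | 1 ≤ (A.filter fun x => ω ∈ openConn o x).card ∧
          (A.filter fun x => ω ∈ openConn o x).card ≤ A.card - 2} ∩
        {ω | (A.filter fun x => ω ∈ openConn q x).card ≤ A.card - 2}) +
      (prodBernoulli w).real ({ω : BondConfig (Fin n) | ∀ t ∈ A.erase q, ω ∉ openConn q t} ∩
        ((⋃ b ∈ A.erase q, openConn o b) ∩
          {ω | ∀ t ∈ (↑(A.erase q) : Set (Fin n)), ∀ t' ∈ (↑(A.erase q) : Set (Fin n)), ω ∈ openConn t t'})) ≤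
    (prodBernoulli w).real {ω : BondConfig (Fin n) |
        (A.filter fun x => ω ∈ openConn q x).card ≤ A.card - 2 ∧
          1 ≤ (A.filter fun x => ω ∈ openConn o x).card} := by
  set μ := prodBernoulli w with hμ
  have hmeas : ∀ s : Set (BondConfig (Fin n)), MeasurableSet s := fun _ => MeasurableSet.of_discrete
  have hgood : ∀ ω : BondConfig (Fin n), ω ∈ ({ω : BondConfig (Fin n) | ∀ t ∈ A.erase q, ω ∉ openConn q t} ∩
      ((⋃ b ∈ A.erase q, openConn o b) ∩
        {ω | ∀ t ∈ (↑(A.erase q) : Set (Fin n)), ∀ t' ∈ (↑(A.erase q) : Set (Fin n)), ω ∈ openConn t t'})) →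
      (A.filter fun x => ω ∈ openConn q x).card ≤ A.card - 2 ∧
        1 ≤ (A.filter fun x => ω ∈ openConn o x).card ∧
        ¬ (A.filter fun x => ω ∈ openConn o x).card ≤ A.card - 2 := by
    rintro ω ⟨hD, hU, hQ⟩
    rw [Set.mem_iUnion₂] at hU
    obtain ⟨b, hb, hob⟩ := hU
    have hbA : b ∈ A := Finset.mem_of_mem_erase hb
    refine ⟨?_, Finset.card_pos.2 ⟨b, Finset.mem_filter.2 ⟨hbA, hob⟩⟩, ?_⟩
    · have hsub : (A.filter fun x => ω ∈ openConn q x) ⊆ {q} := by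
        intro x hx
        obtain ⟨hxA, hqx⟩ := Finset.mem_filter.1 hx
        rw [Finset.mem_singleton]
        by_contra hxq
        exact hD x (Finset.mem_erase.2 ⟨hxq, hxA⟩) hqx
      exact (Finset.card_le_card hsub).trans (by simp; omega)
    · have hsub : A.erase q ⊆ A.filter fun x => ω ∈ openConn o x := by
        intro t ht
        refine Finset.mem_filter.2 ⟨Finset.mem_of_mem_erase ht, ?_⟩
        have hbt : (openGraph ω).Reachable b t := hQ b hb t ht
        exact ((show (openGraph ω).Reachable o b from hob).trans hbt : (openGraph ω).Reachable o t)
      have := Finset.card_le_card hsub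
      rw [Finset.card_erase_of_mem hq] at this
      omega
  have hdisj : Disjoint ({ω : BondConfig (Fin n) | 1 ≤ (A.filter fun x => ω ∈ openConn o x).card ∧
          (A.filter fun x => ω ∈ openConn o x).card ≤ A.card - 2} ∩
        {ω | (A.filter fun x => ω ∈ openConn q x).card ≤ A.card - 2})
      ({ω : BondConfig (Fin n) | ∀ t ∈ A.erase q, ω ∉ openConn q t} ∩
        ((⋃ b ∈ A.erase q, openConn o b) ∩
          {ω | ∀ t ∈ (↑(A.erase q) : Set (Fin n)), ∀ t' ∈ (↑(A.erase q) : Set (Fin n)), ω ∈ openConn t t'})) :=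
    Set.disjoint_left.2 fun ω hω hω' => (hgood ω hω').2.2 hω.1.2
  rw [← measureReal_union hdisj (hmeas _)]
  refine measureReal_mono ?_ (measure_ne_top μ _)
  rintro ω (⟨⟨h1, -⟩, hR⟩ | hω')
  · exact ⟨hR, h1⟩
  · exact ⟨(hgood ω hω').1, (hgood ω hω').2.1⟩

/-- **`R_q ∖ R_d = D_q ∩ Q_q` at level `k − 2`** (`d, q ∈ A`, `d ≠ q`): if `|π(q)| ≤ k−2 < k−1 ≤ |π(d)|` then `d`'s
block is `A ∖ q` and `q` is isolated, and conversely.  Hence the level-`(k−2)` loneliness order is the order of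
`h(x) = μ(D_x ∩ Q_x)`. [folklore] -/
theorem sdiff_eq_partition (A : Finset (Fin n)) {d q : Fin n} (hd : d ∈ A) (hq : q ∈ A) (hdq : d ≠ q)
    (hk : 3 ≤ A.card) :
    {ω : BondConfig (Fin n) | (A.filter fun x => ω ∈ openConn q x).card ≤ A.card - 2} \
      {ω | (A.filter fun x => ω ∈ openConn d x).card ≤ A.card - 2} =
    {ω : BondConfig (Fin n) | ∀ t ∈ A.erase q, ω ∉ openConn q t} ∩
      {ω | ∀ t ∈ (↑(A.erase q) : Set (Fin n)), ∀ t' ∈ (↑(A.erase q) : Set (Fin n)), ω ∈ openConn t t'} := by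
  ext ω
  simp only [Set.mem_sdiff, Set.mem_setOf_eq, Set.mem_inter_iff, not_le, Finset.mem_coe]
  set Sq := A.filter fun x => ω ∈ openConn q x with hSq
  set Sd := A.filter fun x => ω ∈ openConn d x with hSd
  constructor
  · rintro ⟨hqle, hdlt⟩
    -- `q ∉ π(d)` (else the blocks coincide), so `π(d) = A ∖ q` and `q` is isolated
    have hqd : ¬ (openGraph ω).Reachable d q := by
      intro h
      have heq : Sd = Sq := by
        refine Finset.filter_congr fun x _ => ?_
        change (openGraph ω).Reachable d x ↔ (openGraph ω).Reachable q x
        exact ⟨fun hx => h.symm.trans hx, fun hx => h.trans hx⟩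
      rw [heq] at hdlt
      omega
    have hSd_sub : Sd ⊆ A.erase q := fun x hx =>
      Finset.mem_erase.2 ⟨fun h => hqd (h ▸ (Finset.mem_filter.1 hx).2), (Finset.mem_filter.1 hx).1⟩
    have hSd_eq : Sd = A.erase q :=
      Finset.eq_of_subset_of_card_le hSd_sub (by rw [Finset.card_erase_of_mem hq]; omega)
    have hconn : ∀ t ∈ A.erase q, (openGraph ω).Reachable d t := fun t ht => by
      rw [← hSd_eq] at ht; exact (Finset.mem_filter.1 ht).2
    refine ⟨fun t ht hqt => hqd ((hconn t ht).trans (show (openGraph ω).Reachable q t from hqt).symm),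
      fun t ht t' ht' => ((hconn t ht).symm.trans (hconn t' ht') : (openGraph ω).Reachable t t')⟩
  · rintro ⟨hD, hQ⟩
    constructor
    · have hsub : Sq ⊆ {q} := by
        intro x hx
        obtain ⟨hxA, hqx⟩ := Finset.mem_filter.1 hx
        rw [Finset.mem_singleton]
        by_contra hxq
        exact hD x (Finset.mem_erase.2 ⟨hxq, hxA⟩) hqx
      have hcard := Finset.card_le_card hsub
      rw [Finset.card_singleton] at hcard
      omega
    · have hsub : A.erase q ⊆ Sd := by
        intro t ht
        exact Finset.mem_filter.2 ⟨Finset.mem_of_mem_erase ht, hQ d (Finset.mem_erase.2 ⟨hdq, hd⟩) t ht⟩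
      have := Finset.card_le_card hsub
      rw [Finset.card_erase_of_mem hq] at this
      omega

/-- **XZ at level `k − 2` with a non-null separation event (deficiency form).** -/
theorem level_of_pairSep_pos (w : Sym2 (Fin n) → unitInterval) (A : Finset (Fin n)) (o q : Fin n) (δ : ℝ)
    (hδ : 0 ≤ δ) (hq : q ∈ A) (hk : 3 ≤ A.card)
    (hcmp : ∀ d ∈ A,
      (prodBernoulli w).real ({ω : BondConfig (Fin n) | ∀ t ∈ A.erase d, ω ∉ openConn d t} ∩
          {ω | ∀ t ∈ (↑(A.erase d) : Set (Fin n)), ∀ t' ∈ (↑(A.erase d) : Set (Fin n)), ω ∈ openConn t t'}) ≤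
        (prodBernoulli w).real ({ω : BondConfig (Fin n) | ∀ t ∈ A.erase q, ω ∉ openConn q t} ∩
          {ω | ∀ t ∈ (↑(A.erase q) : Set (Fin n)), ∀ t' ∈ (↑(A.erase q) : Set (Fin n)), ω ∈ openConn t t'}) + δ)
    (hM : 0 < (prodBernoulli w).real
      {ω : Set (Sym2 (Fin n)) | ∀ x ∈ A, ∀ y ∈ A, x ≠ y → ω ∉ openConn x y}) :
    (prodBernoulli w).real {ω : BondConfig (Fin n) | 1 ≤ (A.filter fun x => ω ∈ openConn o x).card ∧
        (A.filter fun x => ω ∈ openConn o x).card ≤ A.card - 2} ≤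
      (prodBernoulli w).real {ω : BondConfig (Fin n) |
        (A.filter fun x => ω ∈ openConn q x).card ≤ A.card - 2 ∧
          1 ≤ (A.filter fun x => ω ∈ openConn o x).card} + δ := by
  set μ := prodBernoulli w with hμ
  set L : Set (BondConfig (Fin n)) := {ω | 1 ≤ (A.filter fun x => ω ∈ openConn o x).card ∧
    (A.filter fun x => ω ∈ openConn o x).card ≤ A.card - 2} with hL
  set R : Set (BondConfig (Fin n)) := {ω | (A.filter fun x => ω ∈ openConn q x).card ≤ A.card - 2} with hR
  have hmeas : ∀ s : Set (BondConfig (Fin n)), MeasurableSet s := fun _ => MeasurableSet.of_discrete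
  have hsplit : μ.real L = μ.real (L ∩ R) + μ.real (L \ R) :=
    (measureReal_inter_add_sdiff (μ := μ) (s := L) (t := R) (hmeas R)).symm
  have hcover : μ.real (L \ R) ≤ ∑ d ∈ A.erase q, μ.real
      (openConn o d ∩ {ω : BondConfig (Fin n) | ∀ t ∈ A.erase d, ω ∉ openConn d t} ∩
        {ω | ∀ t ∈ (↑(A.erase d) : Set (Fin n)), ∀ t' ∈ (↑(A.erase d) : Set (Fin n)), ω ∈ openConn t t'}) :=
    (measureReal_mono (cover_sdiff_subset A o q hq) (measure_ne_top μ _)).trans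
      (measureReal_biUnion_finset_le _ _)
  have hchain := chain_of_pairSep_pos w A o q δ hδ hq hcmp hM
  have hgood := good_piece_le w A o q hq hk
  rw [hsplit]
  linarith

/-- **Removing the null case by scaling the weights**: for every weight function, `q ∈ A` with
`h(d) ≤ h(q)` for all `d ∈ A` (`h(d) = μ(D_d ∩ Q_d)`) gives XZ at level `|A| − 2`. -/
theorem level_of_continuity
    (hcont : ∀ (n : ℕ) (E : Set (BondConfig (Fin n))),
      Continuous fun w : Sym2 (Fin n) → unitInterval => (prodBernoulli w).real E)
    (w : Sym2 (Fin n) → unitInterval) (A : Finset (Fin n)) (o q : Fin n) (hq : q ∈ A) (hk : 3 ≤ A.card)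
    (hcmp : ∀ d ∈ A,
      (prodBernoulli w).real ({ω : BondConfig (Fin n) | ∀ t ∈ A.erase d, ω ∉ openConn d t} ∩
          {ω | ∀ t ∈ (↑(A.erase d) : Set (Fin n)), ∀ t' ∈ (↑(A.erase d) : Set (Fin n)), ω ∈ openConn t t'}) ≤
        (prodBernoulli w).real ({ω : BondConfig (Fin n) | ∀ t ∈ A.erase q, ω ∉ openConn q t} ∩
          {ω | ∀ t ∈ (↑(A.erase q) : Set (Fin n)), ∀ t' ∈ (↑(A.erase q) : Set (Fin n)), ω ∈ openConn t t'})) :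
    (prodBernoulli w).real {ω : BondConfig (Fin n) | 1 ≤ (A.filter fun x => ω ∈ openConn o x).card ∧
        (A.filter fun x => ω ∈ openConn o x).card ≤ A.card - 2} ≤
      (prodBernoulli w).real {ω : BondConfig (Fin n) |
        (A.filter fun x => ω ∈ openConn q x).card ≤ A.card - 2 ∧
          1 ≤ (A.filter fun x => ω ∈ openConn o x).card} := by
  -- the guarded isolation events `D_d ∩ Q_d`
  set Hd : Fin n → Set (BondConfig (Fin n)) := fun d =>
    {ω : BondConfig (Fin n) | ∀ t ∈ A.erase d, ω ∉ openConn d t} ∩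
      {ω | ∀ t ∈ (↑(A.erase d) : Set (Fin n)), ∀ t' ∈ (↑(A.erase d) : Set (Fin n)), ω ∈ openConn t t'} with hHd
  -- scaled weights `w_k = (1 - 1/(k+1)) • w`, all `< 1`, converging to `w`
  have hcmem : ∀ k : ℕ, ((1 : ℝ) - 1 / ((k : ℝ) + 1)) ∈ unitInterval := by
    intro k
    have hk' : (0 : ℝ) < (k : ℝ) + 1 := Nat.cast_add_one_pos k
    have h1 : 1 / ((k : ℝ) + 1) ≤ 1 := by
      rw [div_le_one hk']; linarith [(Nat.cast_nonneg k : (0 : ℝ) ≤ k)]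
    have h0 : 0 ≤ 1 / ((k : ℝ) + 1) := by positivity
    exact ⟨by linarith, by linarith⟩
  set wk : ℕ → Sym2 (Fin n) → unitInterval :=
    fun k e => ⟨(1 - 1 / ((k : ℝ) + 1)) * (w e : ℝ), unitInterval.mul_mem (hcmem k) (w e).2⟩
    with hwk_def
  have hwk_lt : ∀ k e, ((wk k e : unitInterval) : ℝ) < 1 := by
    intro k e
    have hk' : (0 : ℝ) < (k : ℝ) + 1 := Nat.cast_add_one_pos k
    have hc : (1 : ℝ) - 1 / ((k : ℝ) + 1) < 1 := by
      have : 0 < 1 / ((k : ℝ) + 1) := by positivity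
      linarith
    calc ((wk k e : unitInterval) : ℝ) = (1 - 1 / ((k : ℝ) + 1)) * (w e : ℝ) := rfl
      _ ≤ (1 - 1 / ((k : ℝ) + 1)) := mul_le_of_le_one_right (hcmem k).1 (w e).2.2
      _ < 1 := hc
  have hc_lim : Tendsto (fun k : ℕ => (1 : ℝ) - 1 / ((k : ℝ) + 1)) atTop (𝓝 1) := by
    simpa using tendsto_const_nhds.sub (tendsto_one_div_add_atTop_nhds_zero_nat (𝕜 := ℝ))
  have hwk_lim : Tendsto wk atTop (𝓝 w) := by
    refine tendsto_pi_nhds.2 fun e => ?_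
    rw [tendsto_subtype_rng]
    have h := hc_lim.mul_const (w e : ℝ)
    rw [one_mul] at h
    exact h
  have hlimE : ∀ E : Set (Set (Sym2 (Fin n))),
      Tendsto (fun k => (prodBernoulli (wk k)).real E) atTop (𝓝 ((prodBernoulli w).real E)) :=
    fun E => ((hcont n E).tendsto w).comp hwk_lim
  -- error terms `δ k = ∑_{a ∈ A} |h_k(a) - h(a)| → 0`
  set δ : ℕ → ℝ := fun k => ∑ a ∈ A,
      |(prodBernoulli (wk k)).real (Hd a) - (prodBernoulli w).real (Hd a)| with hδ_def
  have hδ0 : ∀ k, 0 ≤ δ k := fun k => Finset.sum_nonneg fun a _ => abs_nonneg _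
  have hδ_lim : Tendsto δ atTop (𝓝 0) := by
    have h : ∀ a ∈ A, Tendsto (fun k =>
        |(prodBernoulli (wk k)).real (Hd a) - (prodBernoulli w).real (Hd a)|) atTop (𝓝 0) := by
      intro a _
      simpa using (tendsto_sub_nhds_zero_iff.2 (hlimE (Hd a))).abs
    simpa [hδ_def] using tendsto_finsetSum A h
  have hδa : ∀ k, ∀ a ∈ A,
      |(prodBernoulli (wk k)).real (Hd a) - (prodBernoulli w).real (Hd a)| ≤ δ k := by
    intro k a ha
    exact Finset.single_le_sum (f := fun a =>
        |(prodBernoulli (wk k)).real (Hd a) - (prodBernoulli w).real (Hd a)|) (fun a _ => abs_nonneg _) ha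
  -- the bound at each `k`, with deficiency `2 δ k`
  have hkb : ∀ k, (prodBernoulli (wk k)).real {ω : BondConfig (Fin n) |
        1 ≤ (A.filter fun x => ω ∈ openConn o x).card ∧
          (A.filter fun x => ω ∈ openConn o x).card ≤ A.card - 2} ≤
      (prodBernoulli (wk k)).real {ω : BondConfig (Fin n) |
        (A.filter fun x => ω ∈ openConn q x).card ≤ A.card - 2 ∧
          1 ≤ (A.filter fun x => ω ∈ openConn o x).card} + 2 * δ k := by
    intro k
    refine level_of_pairSep_pos (wk k) A o q (2 * δ k) (by linarith [hδ0 k]) hq hk ?_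
      (singleFinger_pairSep_real_pos (wk k) (hwk_lt k) _)
    intro d hd
    have h1 := hcmp d hd
    have h2 := (abs_sub_le_iff.1 (hδa k d hd)).1
    have h3 := (abs_sub_le_iff.1 (hδa k q hq)).2
    change (prodBernoulli (wk k)).real (Hd d) ≤ (prodBernoulli (wk k)).real (Hd q) + 2 * δ k
    change (prodBernoulli w).real (Hd d) ≤ (prodBernoulli w).real (Hd q) at h1
    linarith
  -- pass to the limit
  have hlim2 : Tendsto (fun k => (prodBernoulli (wk k)).real {ω : BondConfig (Fin n) |
        (A.filter fun x => ω ∈ openConn q x).card ≤ A.card - 2 ∧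
          1 ≤ (A.filter fun x => ω ∈ openConn o x).card} + 2 * δ k) atTop
      (𝓝 ((prodBernoulli w).real {ω : BondConfig (Fin n) |
        (A.filter fun x => ω ∈ openConn q x).card ≤ A.card - 2 ∧
          1 ≤ (A.filter fun x => ω ∈ openConn o x).card})) := by
    simpa using (hlimE _).add (hδ_lim.const_mul 2)
  exact le_of_tendsto_of_tendsto' (hlimE _) hlim2 hkb

end AttachedChampionCardSubTwo

open AttachedChampionCardSubTwo in
/-- **The attached-champion inequality at level `|A| − 2`** (the `j = |A| − 2` instance of the registered stub
`stub_attachedChampion`, unconditional): for every weighted graph on `Fin n`, relay set `A` with `|A| ≥ 3`,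
observer `o` and level-`(|A|−2)` champion `q ∈ A`,
`μ(1 ≤ N ≤ |A|−2) ≤ μ(|π(q)| ≤ |A|−2 ∧ 1 ≤ N)`.  Inputs: BHK 2006 Thms 1.3/1.5 (single vertex and vertex sets,
all discharged in the tree) and weight continuity. -/
theorem attachedChampion_level_card_sub_two (n : ℕ) (w : Sym2 (Fin n) → unitInterval) (A : Finset (Fin n))
    (o q : Fin n) (hk : 3 ≤ A.card) (hq : q ∈ A)
    (hchamp : ∀ a ∈ A,
      (Literature.Probability.LatticeModels.prodBernoulli w).real
          {ω : Literature.Probability.Percolation.BondConfig (Fin n) |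
            (A.filter fun x => ω ∈ Literature.Probability.Percolation.openConn a x).card ≤ A.card - 2} ≤
        (Literature.Probability.LatticeModels.prodBernoulli w).real
          {ω : Literature.Probability.Percolation.BondConfig (Fin n) |
            (A.filter fun x => ω ∈ Literature.Probability.Percolation.openConn q x).card ≤ A.card - 2}) :
    (Literature.Probability.LatticeModels.prodBernoulli w).real
        {ω : Literature.Probability.Percolation.BondConfig (Fin n) |
          1 ≤ (A.filter fun x => ω ∈ Literature.Probability.Percolation.openConn o x).card ∧
            (A.filter fun x => ω ∈ Literature.Probability.Percolation.openConn o x).card ≤ A.card - 2} ≤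
      (Literature.Probability.LatticeModels.prodBernoulli w).real
        {ω : Literature.Probability.Percolation.BondConfig (Fin n) |
          (A.filter fun x => ω ∈ Literature.Probability.Percolation.openConn q x).card ≤ A.card - 2 ∧
            1 ≤ (A.filter fun x => ω ∈ Literature.Probability.Percolation.openConn o x).card} := by
  set μ := prodBernoulli w with hμ
  have hmeas : ∀ s : Set (BondConfig (Fin n)), MeasurableSet s := fun _ => MeasurableSet.of_discrete
  -- the level-`(k−2)` champion maximises `h(d) = μ(D_d ∩ Q_d)`: `μ(R_q) − μ(R_d) = h(q) − h(d)`
  have hcmp : ∀ d ∈ A,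
      μ.real ({ω : BondConfig (Fin n) | ∀ t ∈ A.erase d, ω ∉ openConn d t} ∩
          {ω | ∀ t ∈ (↑(A.erase d) : Set (Fin n)), ∀ t' ∈ (↑(A.erase d) : Set (Fin n)), ω ∈ openConn t t'}) ≤
        μ.real ({ω : BondConfig (Fin n) | ∀ t ∈ A.erase q, ω ∉ openConn q t} ∩
          {ω | ∀ t ∈ (↑(A.erase q) : Set (Fin n)), ∀ t' ∈ (↑(A.erase q) : Set (Fin n)), ω ∈ openConn t t'}) := by
    intro d hd
    by_cases hdq : d = q
    · rw [hdq]
    · set Rq : Set (BondConfig (Fin n)) := {ω | (A.filter fun x => ω ∈ openConn q x).card ≤ A.card - 2}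
      set Rd : Set (BondConfig (Fin n)) := {ω | (A.filter fun x => ω ∈ openConn d x).card ≤ A.card - 2}
      have h1 : μ.real Rq = μ.real (Rq ∩ Rd) + μ.real (Rq \ Rd) :=
        (measureReal_inter_add_sdiff (μ := μ) (s := Rq) (t := Rd) (hmeas Rd)).symm
      have h2 : μ.real Rd = μ.real (Rd ∩ Rq) + μ.real (Rd \ Rq) :=
        (measureReal_inter_add_sdiff (μ := μ) (s := Rd) (t := Rq) (hmeas Rq)).symm
      rw [sdiff_eq_partition A hd hq hdq hk] at h1
      rw [sdiff_eq_partition A hq hd (Ne.symm hdq) hk, Set.inter_comm Rd Rq] at h2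
      have h3 := hchamp d hd
      change μ.real Rd ≤ μ.real Rq at h3
      linarith
  exact level_of_continuity stub_weightContinuity w A o q hq hk hcmp

end Summit.CriticalPhenomena.PercolationContinuityZ3.Theorems

end
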